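import Literature.Geometry.Symplectic.DbarInequalityZeroDichotomy
import Literature.Analysis.Complex.HartmanWintner
import HarnessLib

/-!
# Proof of the zero dichotomy for the `∂̄`-inequality (`dbarInequality_zeroDichotomy`)

`Literature.Geometry.Symplectic.dbarInequality_zeroDichotomy` (vendored from Wendl, *Lectures on
Holomorphic Curves*, Thm 2.50, the similarity principle: a `C¹` map `v` from a disc into a
finite-dimensional complex normed space with `‖∂ₛv + i∂ₜv‖ ≤ K‖v‖` and `v c = 0` either vanishes
near `c` or has an isolated zero at `c`) is DISCHARGED here:
`dbarInequality_zeroDichotomy_holds`.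

The proof is the Hartman–Wintner theorem of the Literature complex-analysis library,
`Literature.Analysis.Complex.hartmanWintner_zero_dichotomy` (Hartman–Wintner (1953); Schulz
(1990), Thm 7.1.1), which is stated for `C¹` maps into any complex Banach space with
`‖∂̄v‖ ≤ K'‖v‖`, `∂̄ = dbarAlong 1 = ½(∂ₛ + i∂ₜ)`; here `∂ₛv + i∂ₜv = 2 ∂̄v`, so `K' = K/2`, and a
finite-dimensional `F` is complete. (Wendl proves Thm 2.50 through the `W^{1,p}` theory of
`∂̄ + A`; the elementary Hartman–Wintner route gives exactly the zero-set consequence that the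
fact records, for `C¹` data, which is what its consumers — unique continuation and the
intersection dichotomy for `J`-holomorphic curves — use.)

## References

* C. Wendl, *Lectures on Holomorphic Curves in Symplectic and Contact Geometry*, arXiv:1011.1690
  (2010), §2.7, Thm 2.50. [WendlLectures2010]
* P. Hartman, A. Wintner, *On the local behavior of solutions of non-parabolic partial
  differential equations*, Amer. J. Math. 75 (1953), 449–476. [HartmanWintner1953]
-/

noncomputable section

open scoped Topology
open Set Filter Metric

namespace Literature.Geometry.Symplectic

open Literature.Analysis.Complex in
/-- **The zero dichotomy for `|∂̄v| ≤ K|v|` holds** (discharge of the named fact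
`dbarInequality_zeroDichotomy`; Wendl, Lectures, Thm 2.50, via Hartman–Wintner (1953)).
[cite: WendlLectures2010, Thm 2.50] -/
theorem dbarInequality_zeroDichotomy_holds : dbarInequality_zeroDichotomy := by
  intro F _ _ _ c r K hr v hv hineq hvc
  haveI : CompleteSpace F := FiniteDimensional.complete ℂ F
  refine hartmanWintner_zero_dichotomy (K := K / 2) hr hv (fun z hz => ?_) hvc
  rw [dbarAlong_one, norm_smul, norm_inv, Complex.norm_two]
  calc 2⁻¹ * ‖fderiv ℝ v z 1 + Complex.I • fderiv ℝ v z Complex.I‖ ≤ 2⁻¹ * (K * ‖v z‖) :=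
        mul_le_mul_of_nonneg_left (hineq z hz) (by norm_num)
    _ = K / 2 * ‖v z‖ := by ring

end Literature.Geometry.Symplectic

end
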